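import Summits.QuantumFields.YangMills.Theorems.BalabanLadderIRTwistedSlabPolymerRepGlue
import HarnessLib

/-!
# `DoublingPolymerRep` is junk-inhabited from the log-doubling bound — K48's `hpoly` is T1's conclusion in costume
(crit-3 g6, CRITIC 2 ∕ PRIMARY IR critic of record, cell ym-ir; B2 ∕ ℓ13 certificate for row 43 of crux `IRcof`, stmt-QuantumFields-26930)

K48 (p708680, `BalabanLadderIRTwistedSlabPolymerRepGlue`) proves `TwistedSlabAnchor` (T1) from `hcl ∧ hpoly`, where `hpoly` asks, for
every `β ≥ β₀`, `L ≥ 2`, `m`, for `Nonempty (DoublingPolymerRep (projSlabZ … L (m+1)) (projSlabZ … L (2(m+1))) m (Y L) α δ rr)` with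
`|Y L| ≤ κ L`, and reads `hpoly` as «the weak-coupling cluster expansion of the e-flux-projected twisted slab, typed — the wall».
This file shows that the structure types ONLY the conclusion: it carries no field tying `(E, w₁, w₂)` to the Gibbs measure of
`projSlabZ`, and `loc` binds only `⌊(m+1)∕2⌋`-short polymers, so the wrapping polymers are free data.

* `nonempty_doublingPolymerRep` — for reals `P₁, P₂ > 0`, `K ≥ 1`, `0 ≤ α ≤ 1`, `δ ≥ 0`, `r ≥ 1` with
  `|2 log P₁ − log P₂| ≤ K·α·e^{−(α+δ)(m+1)}`, `DoublingPolymerRep P₁ P₂ m (Fin K) α δ r` is inhabited: `E = log P₂ ∕ (2m+2)`, `w₂ = 0`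
  (`Ξ₂ = 1`), `w₁ = ε` on the `K` pairwise-disjoint full-time columns `ZMod (m+1) × {y}` and `0` elsewhere, `(1+ε)^K = P₁ ∕ √P₂`
  (`Xi_wcol`: distinct columns are pairwise `¬polyInc`, binomial theorem over the sub-families of columns); `loc` holds because the
  projection of a short set has at most `⌊(m+1)∕2⌋ < m+1` times; columns are time-connected at range `1`; the Kotecký–Preiss inequality
  at `A` sees at most `|A|` columns, each weighing `|ε|·e^{(α+δ)(m+1)} ≤ α`.
* `hpolyBody_of_logDoubling` — hence, for ANY `ρ, z, n, ℓ₀, β₀` (no group theory), the two-sided log-doubling bound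
  `|2 log Z_t − log Z_{2t}| ≤ C·L·e^{−ct}` (`Z_t = projSlabZ ρ β z n ℓ₀ L t`; `β ≥ β₀`, `L ≥ 2`, `t ≥ 1`) gives the body of `hpoly` with
  `Y L = Fin (⌈CL∕α⌉₊ + 1)`, `α = min (c∕2) 1`, `δ = c∕2`, `rr = 1`, `κ = C∕α + 1`.

Conversely K48's `DoublingPolymerRep.log_doubling_ge` gives `hpoly ⇒ 2 log Z_t − log Z_{2t} ≤ 4α·t·|Y L|·e^{−δ⌊t∕2⌋∕(2r)} ≤ C′·L·e^{−c′t}`, and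
`2 log Z_t − log Z_{2t} ≥ 0` for `t ≥ 2` is `projSlabZ_two_mul_le_sq` (K40). So `hpoly` ⟺ «log-T1 at SU(N)» up to constants (and the
`t = 1` sign side): an EQUIV re-cut of T1's analytic conclusion in polymer vocabulary, not the expansion. The reason is generic: the KP
budget of a wrapping polymer of size `m+1` is `α·e^{−(α+δ)(m+1)}` per column, times `≤ κL` columns = exactly T1's right-hand side.
HELPER on the negative lane: no Theses statement is asserted or denied; T1 `TwistedSlabAnchor` stays 0∕1 (M4 = the CONSTRUCTED expansion +
`hcl`); the Yang–Mills mass gap (Clay) is NOT proved by any of this; R4 closes only the conditional finite-𝕋⁴ rung `BalabanLadder.UV`.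
-/

noncomputable section

open Finset
open scoped BigOperators
open Literature.Probability.LatticeModels
open Literature.MathematicalPhysics.QuantumFieldTheory Literature.MathematicalPhysics.QuantumLattice

namespace Summit.QuantumFields.YangMills.Cruxes.IRcof.TwistedSlab.PolymerTorus.Junk

/-! ## Columns (local notation only — this helper file declares no definitions) -/

/-- The full-time column at spatial label `y` (local notation). -/
local notation3 "col[" m ", " K ", " y "]" =>
  ((Finset.univ : Finset (ZMod (m + 1))) ×ˢ ({y} : Finset (Fin K)))

/-- The family of the `K` columns (local notation). -/
local notation3 "cols[" m ", " K "]" => ((Finset.univ : Finset (Fin K)).image fun y => col[m, K, y])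

/-- Junk activities: `ε` on columns, `0` elsewhere (local notation). -/
local notation3 "wcol[" m ", " K ", " ε "]" =>
  (fun A : Finset (ZMod (m + 1) × Fin K) => if A ∈ cols[m, K] then ((ε : ℝ) : ℂ) else (0 : ℂ))

variable {m K : ℕ}

/-- Membership in a column is membership of the spatial label. -/
theorem mem_col {y : Fin K} {p : ZMod (m + 1) × Fin K} : p ∈ col[m, K, y] ↔ p.2 = y := by
  rw [Finset.mem_product]
  simp only [Finset.mem_univ, true_and, Finset.mem_singleton]

/-- Distinct labels give distinct columns. -/
theorem col_injective : Function.Injective (fun y : Fin K => col[m, K, y]) := by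
  intro y y' h
  have : ((0 : ZMod (m + 1)), y) ∈ col[m, K, y'] := by
    have h' : col[m, K, y] = col[m, K, y'] := h
    exact h' ▸ mem_col.2 rfl
  exact mem_col.1 this

/-- Membership in the family of columns. -/
theorem mem_cols {A : Finset (ZMod (m + 1) × Fin K)} : A ∈ cols[m, K] ↔ ∃ y, col[m, K, y] = A := by
  simp only [Finset.mem_image, Finset.mem_univ, true_and]

/-- There are `K` columns. -/
theorem card_cols : (cols[m, K]).card = K := by
  rw [Finset.card_image_of_injective _ col_injective, Finset.card_univ, Fintype.card_fin]

/-- A column has `m + 1` sites. -/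
theorem card_col (y : Fin K) : (col[m, K, y]).card = m + 1 := by
  simp [ZMod.card]

/-- A column occupies every time. -/
theorem times_col (y : Fin K) : times (col[m, K, y]) = Finset.univ := by
  ext s
  simp only [mem_times, Finset.mem_univ, iff_true]
  exact ⟨(s, y), mem_col.2 rfl, rfl⟩

/-- Columns are time-connected at any range `r ≥ 1`. -/
theorem isTimeConnected_col {r : ℕ} (hr : 0 < r) (y : Fin K) : IsTimeConnected r (col[m, K, y]) := by
  classical
  intro T₁ _ hne hne'
  rw [times_col] at hne' ⊢
  obtain ⟨s₀, hs₀⟩ := hne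
  obtain ⟨t₀, ht₀⟩ := hne'
  have ht₀' : t₀ ∉ T₁ := (Finset.mem_sdiff.1 ht₀).2
  have hex : ∃ j : ℕ, s₀ + (j : ZMod (m + 1)) ∉ T₁ := by
    refine ⟨(t₀ - s₀).val, ?_⟩
    have : s₀ + (((t₀ - s₀).val : ℕ) : ZMod (m + 1)) = t₀ := by
      rw [ZMod.natCast_zmod_val]; abel
    rw [this]; exact ht₀'
  have hspec := Nat.find_spec hex
  have h0 : Nat.find hex ≠ 0 := by
    intro h
    rw [h, Nat.cast_zero, add_zero] at hspec
    exact hspec hs₀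
  obtain ⟨j, hj⟩ := Nat.exists_eq_succ_of_ne_zero h0
  have hjmem : s₀ + (j : ZMod (m + 1)) ∈ T₁ := by
    by_contra hc
    exact Nat.find_min hex (by rw [hj]; exact Nat.lt_succ_self j) hc
  rw [hj] at hspec
  refine ⟨s₀ + (j : ZMod (m + 1)), hjmem, s₀ + ((j + 1 : ℕ) : ZMod (m + 1)),
    Finset.mem_sdiff.2 ⟨Finset.mem_univ _, hspec⟩, ?_⟩
  calc cycDist (s₀ + (j : ZMod (m + 1))) (s₀ + ((j + 1 : ℕ) : ZMod (m + 1))) ≤ (1 : ℤ).natAbs :=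
        cycDist_le_natAbs (by push_cast; ring)
    _ = 1 := rfl
    _ ≤ r := hr

/-- An `ℓ`-short set has at most `ℓ` times. -/
theorem card_times_le_of_isTimeShort {N : ℕ} [NeZero N] {Y : Type} [DecidableEq Y] {ℓ : ℕ}
    {A : Finset (ZMod N × Y)} (h : IsTimeShort ℓ A) : (times A).card ≤ ℓ := by
  obtain ⟨a, ha⟩ := h
  calc (times A).card ≤ ((Finset.range ℓ).image fun j : ℕ => a + (j : ZMod N)).card := by
        refine Finset.card_le_card fun s hs => ?_
        obtain ⟨x, hx, rfl⟩ := mem_times.1 hs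
        refine Finset.mem_image.2 ⟨(x.1 - a).val, Finset.mem_range.2 (ha x hx), ?_⟩
        rw [ZMod.natCast_zmod_val]; abel
    _ ≤ (Finset.range ℓ).card := Finset.card_image_le
    _ = ℓ := Finset.card_range ℓ

/-- Projection does not increase the number of times. -/
theorem card_times_projSet_le {N : ℕ} {Y : Type} [DecidableEq Y] (n : ℕ) (A : Finset (ZMod N × Y)) :
    (times (projSet n A)).card ≤ (times A).card := by
  have : times (projSet n A) = (times A).image fun t : ZMod N => (ZMod.cast t : ZMod n) := by
    simp only [times, projSet, Finset.image_image]
    rfl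
  rw [this]
  exact Finset.card_image_le

/-- **Partition function of the junk system**: `Ξ(wcol ε) = (1 + ε)^K` (only sub-families of the `K` pairwise-compatible
columns contribute; binomial theorem). -/
theorem Xi_wcol (ε : ℝ) :
    polymerPartitionFunction polyInc wcol[m, K, ε] (Finset.univ : Finset (Finset (ZMod (m + 1) × Fin K))) =
      ((1 + ε : ℝ) : ℂ) ^ K := by
  classical
  unfold polymerPartitionFunction
  have hsub : (cols[m, K]).powerset ⊆ (Finset.univ : Finset (Finset (ZMod (m + 1) × Fin K))).powerset :=
    Finset.powerset_mono.2 (Finset.subset_univ _)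
  rw [← Finset.sum_subset hsub]
  · have hcompat : ∀ 𝒜 ∈ (cols[m, K]).powerset, IsCompatible polyInc 𝒜 := by
      intro 𝒜 h𝒜
      rw [Finset.mem_powerset] at h𝒜
      intro γ hγ γ' hγ' hne
      obtain ⟨y, rfl⟩ := mem_cols.1 (h𝒜 (Finset.mem_coe.1 hγ))
      obtain ⟨y', rfl⟩ := mem_cols.1 (h𝒜 (Finset.mem_coe.1 hγ'))
      rintro (h | ⟨p, hp⟩)
      · exact hne h
      · rw [Finset.mem_inter, mem_col, mem_col] at hp
        exact hne (by rw [← hp.1, hp.2])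
    calc ∑ 𝒜 ∈ (cols[m, K]).powerset,
          (if IsCompatible polyInc 𝒜 then ∏ γ ∈ 𝒜, (if γ ∈ cols[m, K] then ((ε : ℝ) : ℂ) else (0 : ℂ)) else 0)
        = ∑ 𝒜 ∈ (cols[m, K]).powerset, ((ε : ℂ) ^ 𝒜.card * 1 ^ ((cols[m, K]).card - 𝒜.card)) := by
          refine Finset.sum_congr rfl fun 𝒜 h𝒜 => ?_
          rw [if_pos (hcompat 𝒜 h𝒜), one_pow, mul_one, ← Finset.prod_const]
          refine Finset.prod_congr rfl fun γ hγ => ?_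
          rw [if_pos ((Finset.mem_powerset.1 h𝒜) hγ)]
      _ = ((ε : ℂ) + 1) ^ (cols[m, K]).card := Finset.sum_pow_mul_eq_add_pow _ _ _
      _ = ((1 + ε : ℝ) : ℂ) ^ K := by rw [card_cols, add_comm]; push_cast; ring
  · intro 𝒜 _ h𝒜
    rw [Finset.mem_powerset, Finset.not_subset] at h𝒜
    obtain ⟨γ, hγ, hγc⟩ := h𝒜
    have : ∏ γ ∈ 𝒜, (if γ ∈ cols[m, K] then ((ε : ℝ) : ℂ) else (0 : ℂ)) = 0 :=
      Finset.prod_eq_zero hγ (by rw [if_neg hγc])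
    rw [this, ite_self]

/-- **Junk inhabitant.** `DoublingPolymerRep P₁ P₂ m (Fin K) α δ r` is nonempty whenever
`|2 log P₁ − log P₂| ≤ K · α · e^{−(α+δ)(m+1)}`. -/
theorem nonempty_doublingPolymerRep {P₁ P₂ : ℝ} (h₁ : 0 < P₁) (h₂ : 0 < P₂) (m : ℕ) {K : ℕ} (hK : 0 < K)
    {α δ : ℝ} (hα : 0 ≤ α) (hα1 : α ≤ 1) (hδ : 0 ≤ δ) {r : ℕ} (hr : 0 < r)
    (hbud : |2 * Real.log P₁ - Real.log P₂| ≤ K * α * Real.exp (-((α + δ) * (m + 1)))) :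
    Nonempty (DoublingPolymerRep P₁ P₂ m (Fin K) α δ r) := by
  classical
  obtain ⟨s, hs_def⟩ : ∃ s : ℝ, s = Real.exp (Real.log P₂ / 2) := ⟨_, rfl⟩
  have hs : 0 < s := by rw [hs_def]; exact Real.exp_pos _
  have hss : s * s = P₂ := by rw [hs_def, ← Real.exp_add, add_halves, Real.exp_log h₂]
  obtain ⟨X, hX_def⟩ : ∃ X : ℝ, X = P₁ / s := ⟨_, rfl⟩
  have hX : 0 < X := by rw [hX_def]; exact div_pos h₁ hs
  obtain ⟨ε, hε_def⟩ : ∃ ε : ℝ, ε = X ^ ((K : ℝ)⁻¹) - 1 := ⟨_, rfl⟩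
  have hpow : (1 + ε) ^ K = X := by
    rw [hε_def, add_sub_cancel]; exact Real.rpow_inv_natCast_pow hX.le hK.ne'
  have hKpos : (0 : ℝ) < K := Nat.cast_pos.2 hK
  have hlogX : Real.log X = (2 * Real.log P₁ - Real.log P₂) / 2 := by
    rw [hX_def, Real.log_div h₁.ne' hs.ne', hs_def, Real.log_exp]; ring
  obtain ⟨u, hu_def⟩ : ∃ u : ℝ, u = Real.log X * (K : ℝ)⁻¹ := ⟨_, rfl⟩
  have hεu : ε = Real.exp u - 1 := by rw [hε_def, hu_def, Real.rpow_def_of_pos hX]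
  have hu : |u| = |2 * Real.log P₁ - Real.log P₂| / (2 * K) := by
    rw [hu_def, hlogX, abs_mul, abs_div, abs_inv, abs_of_pos hKpos, abs_two]; ring
  have hexp1 : Real.exp (-((α + δ) * (m + 1))) ≤ 1 := by
    rw [Real.exp_le_one_iff]
    have : 0 ≤ (α + δ) * (m + 1) := by positivity
    linarith
  have hu1 : |u| ≤ 1 := by
    rw [hu, div_le_iff₀ (by positivity)]
    calc |2 * Real.log P₁ - Real.log P₂| ≤ K * α * Real.exp (-((α + δ) * (m + 1))) := hbud
      _ ≤ K * 1 * 1 := by gcongr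
      _ ≤ 1 * (2 * K) := by linarith
  have hεabs : |ε| ≤ |2 * Real.log P₁ - Real.log P₂| / K := by
    rw [hεu]
    calc |Real.exp u - 1| ≤ 2 * |u| := Real.abs_exp_sub_one_le hu1
      _ = |2 * Real.log P₁ - Real.log P₂| / K := by rw [hu]; field_simp
  have hεB : |ε| * Real.exp ((α + δ) * (m + 1)) ≤ α := by
    calc |ε| * Real.exp ((α + δ) * (m + 1))
        ≤ (|2 * Real.log P₁ - Real.log P₂| / K) * Real.exp ((α + δ) * (m + 1)) := by gcongr
      _ ≤ (K * α * Real.exp (-((α + δ) * (m + 1))) / K) * Real.exp ((α + δ) * (m + 1)) := by gcongr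
      _ = α * (Real.exp (-((α + δ) * (m + 1))) * Real.exp ((α + δ) * (m + 1))) := by
          field_simp
      _ = α := by rw [← Real.exp_add, neg_add_cancel, Real.exp_zero, mul_one]
  have hB : ∀ A' ∈ cols[m, K], ‖(if A' ∈ cols[m, K] then ((ε : ℝ) : ℂ) else (0 : ℂ))‖ *
      Real.exp (α * (A'.card : ℝ) + δ * (A'.card : ℝ)) ≤ α := by
    intro A' hA'
    obtain ⟨y, rfl⟩ := mem_cols.1 hA'
    rw [if_pos hA', card_col, Complex.norm_real, Real.norm_eq_abs]
    calc |ε| * Real.exp (α * ((m + 1 : ℕ) : ℝ) + δ * ((m + 1 : ℕ) : ℝ))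
        = |ε| * Real.exp ((α + δ) * (m + 1)) := by push_cast; ring_nf
      _ ≤ α := hεB
  have hΞ0 : polymerPartitionFunction polyInc (fun _ : Finset (ZMod (2 * m + 2) × Fin K) => (0 : ℂ))
      (Finset.univ : Finset (Finset (ZMod (2 * m + 2) × Fin K))) = 1 := by
    have := polymerPartitionFunction_zero_mul (inc := polyInc)
      (fun _ : Finset (ZMod (2 * m + 2) × Fin K) => (0 : ℂ)) Finset.univ
    simpa using this
  have h2ne : (2 * ((m : ℝ) + 1)) ≠ 0 := by positivity
  refine ⟨{ E := (((Real.log P₂ / (2 * ((m : ℝ) + 1))) : ℝ) : ℂ)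
            w₁ := wcol[m, K, ε]
            w₂ := fun _ => 0
            a₁ := fun A => α * (A.card : ℝ)
            d₁ := fun A => δ * (A.card : ℝ)
            a₂ := fun A => α * (A.card : ℝ)
            d₂ := fun A => δ * (A.card : ℝ)
            rep₁ := ?_
            rep₂ := ?_
            loc := ?_
            conn₁ := ?_
            conn₂ := ?_
            a₁_nonneg := fun A => by positivity
            d₁_ge := fun A => le_rfl
            kp₁ := ?_
            a₁_singleton_le := fun x => by simp
            a₂_nonneg := fun A => by positivity
            d₂_ge := fun A => le_rfl
            kp₂ := ?_
            a₂_singleton_le := fun x => by simp }⟩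
  · -- rep₁
    rw [Xi_wcol]
    have hexpR : ((m + 1 : ℕ) : ℝ) * (Real.log P₂ / (2 * ((m : ℝ) + 1))) = Real.log P₂ / 2 := by
      push_cast; field_simp
    have hexp : Complex.exp (((m + 1 : ℕ) : ℂ) * (((Real.log P₂ / (2 * ((m : ℝ) + 1))) : ℝ) : ℂ)) =
        ((s : ℝ) : ℂ) := by
      rw [hs_def, Complex.ofReal_exp, ← hexpR]; push_cast; ring_nf
    rw [hexp]
    have key : s * (1 + ε) ^ K = P₁ := by rw [hpow, hX_def]; field_simp
    exact_mod_cast key.symm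
  · -- rep₂
    rw [hΞ0, mul_one]
    have hexpR : ((2 * m + 2 : ℕ) : ℝ) * (Real.log P₂ / (2 * ((m : ℝ) + 1))) = Real.log P₂ := by
      push_cast; field_simp
    have hE : ((2 * m + 2 : ℕ) : ℂ) * (((Real.log P₂ / (2 * ((m : ℝ) + 1))) : ℝ) : ℂ) =
        ((Real.log P₂ : ℝ) : ℂ) := by
      exact_mod_cast hexpR
    rw [hE, ← Complex.ofReal_exp, Real.exp_log h₂]
  · -- loc
    intro A hA
    show (0 : ℂ) = (if projSet (m + 1) A ∈ cols[m, K] then ((ε : ℝ) : ℂ) else (0 : ℂ))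
    have hnot : projSet (m + 1) A ∉ cols[m, K] := by
      intro h
      obtain ⟨y, hy⟩ := mem_cols.1 h
      have h1 : (times (projSet (m + 1) A)).card ≤ (m + 1) / 2 :=
        (card_times_projSet_le _ _).trans (card_times_le_of_isTimeShort hA)
      rw [← hy, times_col, Finset.card_univ, ZMod.card] at h1
      omega
    rw [if_neg hnot]
  · -- conn₁
    intro A hA
    by_cases h : A ∈ cols[m, K]
    · obtain ⟨y, rfl⟩ := mem_cols.1 h
      exact ⟨⟨((0 : ZMod (m + 1)), y), mem_col.2 rfl⟩, isTimeConnected_col hr y⟩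
    · exact absurd (by rw [if_neg h]) hA
  · -- conn₂
    intro A hA
    exact absurd rfl hA
  · -- kp₁
    intro A
    calc ∑ A' ∈ Finset.univ with polyInc A' A,
          ‖(if A' ∈ cols[m, K] then ((ε : ℝ) : ℂ) else (0 : ℂ))‖ * Real.exp (α * (A'.card : ℝ) + δ * (A'.card : ℝ))
        = ∑ A' ∈ (Finset.univ.filter fun A' => polyInc A' A).filter (· ∈ cols[m, K]),
            ‖(if A' ∈ cols[m, K] then ((ε : ℝ) : ℂ) else (0 : ℂ))‖ *
              Real.exp (α * (A'.card : ℝ) + δ * (A'.card : ℝ)) := by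
          symm
          apply Finset.sum_subset (Finset.filter_subset _ _)
          intro A' hA' hA'n
          have : A' ∉ cols[m, K] := fun h => hA'n (Finset.mem_filter.2 ⟨hA', h⟩)
          rw [if_neg this]; simp
      _ ≤ ∑ A' ∈ (Finset.univ.filter fun A' => polyInc A' A).filter (· ∈ cols[m, K]), α :=
          Finset.sum_le_sum fun A' hA' => hB A' (Finset.mem_filter.1 hA').2
      _ = (((Finset.univ.filter fun A' => polyInc A' A).filter (· ∈ cols[m, K])).card : ℝ) * α := by
          rw [Finset.sum_const, nsmul_eq_mul]
      _ ≤ (A.card : ℝ) * α := by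
          gcongr
          calc ((Finset.univ.filter fun A' => polyInc A' A).filter (· ∈ cols[m, K])).card
              ≤ ((A.image Prod.snd).image fun y => col[m, K, y]).card := by
                refine Finset.card_le_card fun A' hA' => ?_
                rw [Finset.mem_filter, Finset.mem_filter] at hA'
                obtain ⟨⟨-, hinc⟩, hc⟩ := hA'
                obtain ⟨y, rfl⟩ := mem_cols.1 hc
                rw [Finset.mem_image]
                refine ⟨y, ?_, rfl⟩
                rw [Finset.mem_image]
                rcases hinc with h | ⟨p, hp⟩
                · exact ⟨(0, y), h ▸ mem_col.2 rfl, rfl⟩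
                · rw [Finset.mem_inter] at hp
                  exact ⟨p, hp.2, mem_col.1 hp.1⟩
            _ ≤ (A.image Prod.snd).card := Finset.card_image_le
            _ ≤ A.card := Finset.card_image_le
      _ = α * (A.card : ℝ) := mul_comm _ _
  · -- kp₂
    intro A
    simp only [norm_zero, zero_mul, Finset.sum_const_zero]
    positivity

section Anchor

variable {G : Type*} [Group G] [TopologicalSpace G] [IsTopologicalGroup G] [CompactSpace G]
  [MeasurableSpace G] [BorelSpace G] {Nc : ℕ}

/-- **`hpoly` is T1's conclusion in costume.** For ANY `ρ, z, n, ℓ₀, β₀`: the two-sided log-doubling bound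
`|2 log Z_t − log Z_{2t}| ≤ C·L·e^{−ct}` (β ≥ β₀, L ≥ 2, t ≥ 1) yields the body of K48's `hpoly`, with
`Y L = Fin (⌈CL/α⌉₊ + 1)`, `α = min (c/2) 1`, `δ = c/2`, `rr = 1`, `κ = C/α + 1`. -/
theorem hpolyBody_of_logDoubling (ρ : G →* Matrix (Fin Nc) (Fin Nc) ℂ) (β₀ : ℝ) (z : G) (n ℓ₀ : ℕ)
    {c C : ℝ} (hc : 0 < c) (hC : 0 ≤ C)
    (hpos : ∀ β : ℝ, β₀ ≤ β → ∀ L t : ℕ, 2 ≤ L → 1 ≤ t → 0 < projSlabZ ρ β z n ℓ₀ L t)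
    (hlog : ∀ β : ℝ, β₀ ≤ β → ∀ L t : ℕ, 2 ≤ L → 1 ≤ t →
      |2 * Real.log (projSlabZ ρ β z n ℓ₀ L t) - Real.log (projSlabZ ρ β z n ℓ₀ L (2 * t))| ≤
        C * (L : ℝ) * Real.exp (-(c * (t : ℝ)))) :
    ∃ (Y : ℕ → Type) (_ : ∀ L, Fintype (Y L)) (_ : ∀ L, DecidableEq (Y L)) (κ α δ : ℝ) (rr : ℕ),
      0 ≤ α ∧ 0 < δ ∧ 0 < rr ∧ (∀ L, 2 ≤ L → (Fintype.card (Y L) : ℝ) ≤ κ * L) ∧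
      ∀ β : ℝ, β₀ ≤ β → ∀ L : ℕ, 2 ≤ L → ∀ m : ℕ,
        Nonempty (DoublingPolymerRep (projSlabZ ρ β z n ℓ₀ L (m + 1)) (projSlabZ ρ β z n ℓ₀ L (2 * (m + 1)))
          m (Y L) α δ rr) := by
  classical
  set α : ℝ := min (c / 2) 1 with hα_def
  have hα : 0 < α := lt_min (by linarith) one_pos
  have hα1 : α ≤ 1 := min_le_right _ _
  have hαc : α ≤ c / 2 := min_le_left _ _
  set Kf : ℕ → ℕ := fun L => ⌈C * L / α⌉₊ + 1 with hKf
  refine ⟨fun L => Fin (Kf L), fun L => inferInstance, fun L => inferInstance, C / α + 1, α, c / 2, 1,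
    hα.le, by linarith, one_pos, ?_, ?_⟩
  · intro L hL
    have hL' : (2 : ℝ) ≤ L := by exact_mod_cast hL
    have h0 : 0 ≤ C * L / α := by positivity
    have hceil : (⌈C * L / α⌉₊ : ℝ) < C * L / α + 1 := Nat.ceil_lt_add_one h0
    simp only [Fintype.card_fin, hKf]
    push_cast
    have : C * L / α + 1 + 1 ≤ (C / α + 1) * L := by
      rw [add_mul, div_mul_eq_mul_div]
      linarith
    linarith
  · intro β hβ L hL m
    have hK : 0 < Kf L := Nat.succ_pos _
    have h₁ := hpos β hβ L (m + 1) hL (by omega)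
    have h₂ := hpos β hβ L (2 * (m + 1)) hL (by omega)
    refine nonempty_doublingPolymerRep h₁ h₂ m hK hα.le hα1 (by linarith) one_pos ?_
    have hb := hlog β hβ L (m + 1) hL (by omega)
    calc |2 * Real.log (projSlabZ ρ β z n ℓ₀ L (m + 1)) - Real.log (projSlabZ ρ β z n ℓ₀ L (2 * (m + 1)))|
        ≤ C * (L : ℝ) * Real.exp (-(c * (((m + 1 : ℕ) : ℝ)))) := hb
      _ ≤ ((Kf L : ℕ) : ℝ) * α * Real.exp (-((α + c / 2) * (m + 1))) := by
          have hKL : C * (L : ℝ) ≤ ((Kf L : ℕ) : ℝ) * α := by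
            have hceil : C * L / α ≤ (⌈C * L / α⌉₊ : ℝ) := Nat.le_ceil _
            simp only [hKf]
            push_cast
            rw [div_le_iff₀ hα] at hceil
            nlinarith
          have hexp : Real.exp (-(c * (((m + 1 : ℕ) : ℝ)))) ≤ Real.exp (-((α + c / 2) * (m + 1))) := by
            rw [Real.exp_le_exp]
            push_cast
            have : 0 ≤ ((m : ℝ) + 1) := by positivity
            nlinarith
          have hε0 : 0 ≤ Real.exp (-(c * (((m + 1 : ℕ) : ℝ)))) := (Real.exp_pos _).le
          calc C * (L : ℝ) * Real.exp (-(c * (((m + 1 : ℕ) : ℝ))))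
              ≤ ((Kf L : ℕ) : ℝ) * α * Real.exp (-(c * (((m + 1 : ℕ) : ℝ)))) := by gcongr
            _ ≤ ((Kf L : ℕ) : ℝ) * α * Real.exp (-((α + c / 2) * (m + 1))) := by gcongr

end Anchor

end Summit.QuantumFields.YangMills.Cruxes.IRcof.TwistedSlab.PolymerTorus.Junk
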